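import Summits.QuantumFields.YangMills.Theorems.BalabanUVNodesN16Thm4TorusOfHP2PerPrintSlot
import Summits.QuantumFields.YangMills.Theorems.BalabanUVNodesN16OfLeaf

/-!
# Route «BalabanUVNodes», crux K3⁸ `SpineGivenEndpointR13SepCoPHV` (stmt-QuantumFields-27366), node N16 = NE3 — NODE N05's WITNESS SLOT OF RECORD READ IN THE EXACT
# LETTERS OF NODE N16's CHAIN ENTRY (`…N16HolderOfThm4Output.n16_holder_of_thm4TorusAt_print`): the η = L⁻ᵏ ∕ `len e_μ = 1` simplification of the print-list edition
# (`…N16Thm4TorusOfHP2PerPrintSlot`) — weights `(Lᵏ·L⁻ᵏ) = 1` killed, every nearest-neighbour pair admissible, lattice periodicity ⟺ per-direction periodicity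

Cell `pub-ymgap`, seat `pub-ymgap-dag-n16-e` (R134 (a), strategy s2; HUMAN RULING D-0062; chair R424 venue), generation 23.  `--kind proof --supports stmt-QuantumFields-27366 --as helper`
(count-neutral; proves NO registered stub).  `bears_on: R4∕N16 · edge N05 → N16`.

WHY.  N16's chain entry consumes, for every `k ≥ 1`, `Thm4TorusAt L k (N·Lᵏ) (Lᵏ)⁻¹ c₁ (unitaryUnits (M_n ℂ)) (Reg335Zd …) (Restr129 L k (torusLam k)) Concl_entry(B, B_h; β)` with
`Concl_entry` in k-FREE letters: `‖A‖ ≤ B s`, `‖D A‖ ≤ B s`, (1.38), `‖R(U₀(y,μ)) (D_μA_κ)(y+e_μ) − (D_μA_κ)(y)‖ ≤ B_h s ((L⁻¹)ᵏ)^β`, `‖Δ A‖ ≤ B s`, per-direction periodicity of `A`.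
`…PrintSlot.exists_thm4TorusAt_print_of_b8LeafOfRecordSubBP₂DPerκ` delivers the same at the period `P` from node N05's κ-slot but in the η-weighted letters of n16-c's `Concl_P`
(`(Lᵏη)⁻¹`, `(Lᵏη)^{−2}`, the (3.40) quotient with `(η len e_μ)^β` on `AdmPair η len`, `(Lᵏη)^{−3}`) and with `IsPeriodic P A`.  At `η = L⁻ᵏ` and `len e_μ = 1` the two conclusion
slots are pointwise EQUIVALENT (n16-c `…N16OfLeaf.thm4TorusAt_print_of_leaf`'s letter identities; `B8LeafModelZdPer.isPeriodic_iff_shiftCfg` for the periodicity line), and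
`Thm4TorusAt` is extensional in its conclusion slot (`…N16OfLeaf.thm4TorusAt_concl_congr`).  THIS FILE performs that rewrite once, so the successor's top knit (plan g87 (B) ∕ trigger
t4′) is ONE application per `k` at `P_k := Nper·Lᵏ` — modulo (g6) (uniformity of the slot's thresholds ∕ letters in `P`, LOCATED note) and the `conjR ↔ Ad` ∕ `θ.𝔸 = M_N ℂ`
identification at the record (definitional for the matrix algebra).

WHAT THIS FILE PROVES (kernel; theorems only, 0 `def`, 0 `sorry`): `isPeriodic_iff_forall_e` (lattice periodicity of a bond field ⟺ per-direction periodicity, pointwise), and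
★★★ `thm4TorusAt_entry_of_b8LeafOfRecordSubBP₂DPerκ` — node N05's κ-slot `Node00.B8LeafOfRecordSubBP₂DPerκ θ P M₁ R lam` (letters `0 ≤ β`, `len ≥ 1` on support, `len e_μ = 1`,
`0 < B₁′`, `5DL·inp.B₀ ≤ B₁′` on `lam.base`; `θ.D ≥ 2`) ⟹ `∃ c₁ cP > 0, ∀ c₁′ ∈ window, ∀` depth `k ≥ 1` with `Lᵏ ∣ P`:
`Thm4TorusAt θ.L k P (Lᵏ)⁻¹ c₁′ (unitaryUnits θ.𝔸) Reg (Restr129 θ.L k (torusLam k)) Concl_entry(5DL·inp.B₀, 5DL·B₀β; β)`.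

HONEST FRAMING.  Bookkeeping BY NAME (letter identities at `η = L⁻ᵏ`); no estimate; the slot is a HYPOTHESIS; thresholds `c₁, cP` and the `lam.base` letters remain PER SLOT INSTANCE
((g6) NOT supplied); nothing of Bałaban asserted; no stub closed or claimed; N16 ∕ N05 NOT discharged; counts UNMOVED (typed 28∕28 · discharged 5∕27 · A 5∕28).  One finite four-torus
at fixed `ε` — NOT ℝ⁴, NOT infinite volume, NOT OS, NOT a mass gap; the YM mass gap (Clay) is NOT proved by any of this.
References: [Balaban1985RegularSpaces] T. Bałaban, CMP **99** (1985) 75–102, Thm 4 p. 88, Prop. 3 p. 87, (1.36)–(1.39) pp. 82–83, p. 77.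
-/

set_option autoImplicit false

open scoped BigOperators
open NormedSpace

namespace Summit.QuantumFields.YangMills.BalabanUVNodes.N16.Thm4TorusOfHP2PerEntry

open Literature.MathematicalPhysics.QuantumFieldTheory.Balaban1983to89
open B7Prop1Explicit B7Prop2Explicit
open B7Prop3Flat (c3)
open B7Eq78Linearization (conjR)
open B7Eq92Concrete (mgauge)
open B8Ineq132 (covDerivFwd)
open B8Eq184Proof (cfgExp)
open B8Eq119TwistedAxial (Restr129)
open B8Eq138LandauZd (IsLandau138 covLap)
open B9Eq340HolderZd (AdmPair mem_admPair)
open B8Thm4TorusAt (torusLam Thm4TorusAt)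
open B8LeafModelZdPer (isPeriodic_iff_shiftCfg)
open B12Ineq417Flat (shiftCfg shiftCfg_apply)
open T4TermwiseTorus (IsPeriodic)
open Node00 (Stage3Params ResidB8Per B8LeafOfRecordSubBP₂DPerκ)
open Thm4TorusOfHP2PerPrintSlot (exists_thm4TorusAt_print_of_b8LeafOfRecordSubBP₂DPerκ)
open OfLeaf (thm4TorusAt_concl_congr)

noncomputable section

variable {d : ℕ}

/-- **Lattice periodicity of a bond field ⟺ per-direction periodicity, pointwise** (`B8LeafModelZdPer.isPeriodic_iff_shiftCfg` unbundled to the letter of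
`…N16HolderOfThm4Output.n16_holder_of_thm4TorusAt_print`). [cite: Balaban1985RegularSpaces, p.77 («Ω₀ = T_η»: fields on the finite torus)] -/
theorem isPeriodic_iff_forall_e {β : Type*} (P : ℕ) (A : Site d → Fin d → β) :
    IsPeriodic P A ↔ ∀ (x : Site d) (κ μ : Fin d), A (x + ((P : ℕ) : ℤ) • e κ) μ = A x μ := by
  rw [isPeriodic_iff_shiftCfg]
  constructor
  · intro h x κ μ
    have hx := congrFun (h κ) x
    rw [shiftCfg_apply] at hx
    exact congrFun hx μ
  · intro h κ
    funext x μ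
    rw [shiftCfg_apply]
    exact h x κ μ

/-- **★★★ NODE N05's WITNESS SLOT OF RECORD, READ IN NODE N16's CHAIN-ENTRY LETTERS.**  For `θ` with `θ.D ≥ 2`, period `P`, pins `(M₁, R)`, residual layer `lam` with
`0 ≤ lam.base.β`, `lam.base.len ≥ 1` on its support and `lam.base.len (e μ) = 1`, `0 < lam.base.B₁′`, `5·D·L·lam.base.inp.B₀ ≤ lam.base.B₁′`: the κ-periodic δ₂-slot
`Node00.B8LeafOfRecordSubBP₂DPerκ θ P M₁ R lam` gives `c₁, cP > 0` such that for every `c₁′` in the eleven-line window, every `k ≥ 1` with `Lᵏ ∣ P` (`0 < P`), every `Reg`: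
`Thm4TorusAt θ.L k P (Lᵏ)⁻¹ c₁′ (unitaryUnits θ.𝔸) Reg (Restr129 θ.L k (torusLam k)) Concl_entry` — `∃ A` self-adjoint, `A (x + P•e_κ) = A x`, `mgauge U₀ u (cfgExp (Lᵏ)⁻¹ A) = U′`,
`‖A‖ ≤ B s`, `‖D^η_{U₀,μ}A_κ‖ ≤ B s`, `IsLandau138 θ.L k (Lᵏ)⁻¹ univ (torusLam k) U₀ A`, `‖R(U₀(y,μ))(D_μA_κ)(y+e_μ) − (D_μA_κ)(y)‖ ≤ B_h s ((L⁻¹)ᵏ)^β`, `‖Δ^η_{U₀}A_κ‖ ≤ B s`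
(`B = 5DL·inp.B₀`, `B_h = 5DL·B₀β`, `s = α₀ + α₁`; `R(·) = conjR`, `= Ad` on `M_n ℂ`).  `…PrintSlot` at `η = (Lᵏ)⁻¹` through `thm4TorusAt_concl_congr`.
[cite: Balaban1985RegularSpaces, Thm 4 p.88, Prop. 3 p.87, (1.36)–(1.39) pp.82–83, p.77 («we admit the case where some domains Ω_j are equal to T_η»)] -/
theorem thm4TorusAt_entry_of_b8LeafOfRecordSubBP₂DPerκ {θ : Stage3Params} (hD : 2 ≤ θ.D) {P M₁ R : ℕ} (lam : ResidB8Per θ P)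
    (h : B8LeafOfRecordSubBP₂DPerκ θ P M₁ R lam) (hβ : 0 ≤ lam.base.β) (hlen : ∀ v : Site θ.D, 0 < lam.base.len v → 1 ≤ lam.base.len v)
    (hlen1 : ∀ μ : Fin θ.D, lam.base.len (e μ) = 1)
    (hB₁' : 0 < lam.base.B₁') (hBB : 5 * (θ.D : ℝ) * θ.L * lam.base.inp.B₀ ≤ lam.base.B₁')
    {k : ℕ} (hk : 1 ≤ k) (hP : 0 < P) (hdvd : θ.L ^ k ∣ P) (Reg : (Site θ.D → Fin θ.D → θ.𝔸ˣ) → Prop) :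
    ∃ c₁ cP : ℝ, 0 < c₁ ∧ 0 < cP ∧ ∀ c₁' : ℝ,
      (∀ α₀ α₁ : ℝ, 0 < α₀ → 0 < α₁ → α₀ + α₁ ≤ c₁' →
        α₀ + α₁ ≤ c₁ ∧ C0 θ.D * (2 * α₀) ≤ 1 / 3 ∧ 4 * α₀ ≤ c2' θ.D θ.L ∧ 16 * (lam.base.B₁' * (α₀ + α₁)) ≤ 1 ∧
        Real.exp (4 * (800 * ((θ.D : ℝ) + 1) ^ 2 * ((θ.D : ℝ) + 4)) * α₀) * (1 + 8 * (131072 * ((θ.D : ℝ) + 1) ^ 2) * (lam.base.B₁' * (α₀ + α₁))) ≤ 2 ∧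
        2 * (lam.base.B₁' * (α₀ + α₁)) ≤ c3 θ.D θ.L ∧ (θ.D : ℝ) * θ.L * α₁ ≤ 1 / 8 ∧ α₀ ≤ cP ∧ α₁ ≤ cP ∧ lam.base.B₁' * (α₀ + α₁) ≤ cP ∧
        2 * (lam.base.B₁' * (α₀ + α₁)) ^ 2 + 20 * θ.D * α₀ * (lam.base.B₁' * (α₀ + α₁)) + 2 * lam.base.C₂ * (lam.base.B₁' * (α₀ + α₁)) ^ 2 ≤ α₀ + α₁) →
      Thm4TorusAt θ.L k (P : ℤ) (((θ.L : ℝ) ^ k)⁻¹) c₁' (unitaryUnits θ.𝔸) Reg (Restr129 θ.L k (torusLam k))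
        (fun (α₀ α₁ : ℝ) (U₀ U' : Site θ.D → Fin θ.D → θ.𝔸ˣ) (u : Site θ.D → θ.𝔸ˣ) =>
          ∃ A : Site θ.D → Fin θ.D → θ.𝔸,
            (∀ x μ, IsSelfAdjoint (A x μ)) ∧ (∀ (x : Site θ.D) (κ μ : Fin θ.D), A (x + ((P : ℕ) : ℤ) • e κ) μ = A x μ) ∧
            mgauge U₀ u (cfgExp (((θ.L : ℝ) ^ k)⁻¹) A) = U' ∧
            (∀ x μ, ‖A x μ‖ ≤ 5 * (θ.D : ℝ) * θ.L * lam.base.inp.B₀ * (α₀ + α₁)) ∧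
            (∀ (μ : Fin θ.D) (x : Site θ.D) (κ : Fin θ.D),
              ‖covDerivFwd (((θ.L : ℝ) ^ k)⁻¹) U₀ μ (fun z => A z κ) x‖ ≤ 5 * (θ.D : ℝ) * θ.L * lam.base.inp.B₀ * (α₀ + α₁)) ∧
            IsLandau138 θ.L k (((θ.L : ℝ) ^ k)⁻¹) Set.univ (torusLam k) U₀ A ∧
            (∀ (μ : Fin θ.D) (y : Site θ.D) (κ : Fin θ.D),
              ‖conjR (U₀ y μ) (covDerivFwd (((θ.L : ℝ) ^ k)⁻¹) U₀ μ (fun z => A z κ) (y + e μ)) - covDerivFwd (((θ.L : ℝ) ^ k)⁻¹) U₀ μ (fun z => A z κ) y‖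
                ≤ 5 * (θ.D : ℝ) * θ.L * lam.base.B₀β * (α₀ + α₁) * (((θ.L : ℝ)⁻¹) ^ k) ^ lam.base.β) ∧
            (∀ (x : Site θ.D) (κ : Fin θ.D),
              ‖covLap (((θ.L : ℝ) ^ k)⁻¹) U₀ (fun z => A z κ) x‖ ≤ 5 * (θ.D : ℝ) * θ.L * lam.base.inp.B₀ * (α₀ + α₁))) := by
  obtain ⟨c₁, cP, hc₁, hcP, H⟩ := exists_thm4TorusAt_print_of_b8LeafOfRecordSubBP₂DPerκ hD lam h hβ hlen hB₁' hBB hk hP hdvd Reg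
  refine ⟨c₁, cP, hc₁, hcP, fun c₁' hwin => thm4TorusAt_concl_congr (fun α₀ α₁ U₀ U' u => ?_) (H c₁' hwin)⟩
  -- the letter identities at `η = L^{-k}`
  have hL1r : (1 : ℝ) ≤ θ.L := by exact_mod_cast le_trans (by norm_num) θ.two_le_L
  have hLk : (1 : ℝ) ≤ (θ.L : ℝ) ^ k := one_le_pow₀ hL1r
  have hη1 : ((θ.L : ℝ) ^ k)⁻¹ ≤ 1 := inv_le_one_of_one_le₀ hLk
  have hw : (θ.L : ℝ) ^ k * ((θ.L : ℝ) ^ k)⁻¹ = 1 := mul_inv_cancel₀ (by positivity)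
  have hw2 : ((θ.L : ℝ) ^ k * ((θ.L : ℝ) ^ k)⁻¹) ^ (-(2 : ℝ)) = 1 := by rw [hw, Real.one_rpow]
  have hw3 : ((θ.L : ℝ) ^ k * ((θ.L : ℝ) ^ k)⁻¹) ^ (-(3 : ℝ)) = 1 := by rw [hw, Real.one_rpow]
  have hwβ : ((θ.L : ℝ) ^ k * ((θ.L : ℝ) ^ k)⁻¹) ^ (-(2 + lam.base.β)) = 1 := by rw [hw, Real.one_rpow]
  have hηβ : ∀ μ : Fin θ.D, (((θ.L : ℝ) ^ k)⁻¹ * lam.base.len (e μ)) ^ lam.base.β = (((θ.L : ℝ)⁻¹) ^ k) ^ lam.base.β := fun μ => by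
    rw [hlen1 μ, mul_one, inv_pow]
  have hadm : ∀ (μ : Fin θ.D) (y : Site θ.D), (y, y + e μ) ∈ AdmPair (((θ.L : ℝ) ^ k)⁻¹) lam.base.len := fun μ y => by
    rw [mem_admPair]
    simp only [add_sub_cancel_left, hlen1 μ, mul_one]
    exact ⟨one_pos, hη1⟩
  constructor
  · rintro ⟨A, h1, hper, h2, h3, h4, h5, h6, h7⟩
    refine ⟨A, h1, (isPeriodic_iff_forall_e P A).1 hper, h2, fun x μ => ?_, fun μ x κ => ?_, h5, fun μ y κ => ?_, fun x κ => ?_⟩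
    · have h := h3 x μ; rwa [hw, inv_one, mul_one] at h
    · have h := h4 μ x κ; rwa [hw2, mul_one] at h
    · have h := h6 μ y κ (hadm μ y); rwa [hwβ, mul_one, hηβ μ] at h
    · have h := h7 x κ; rwa [hw3, mul_one] at h
  · rintro ⟨A, h1, hper, h2, h3, h4, h5, h6, h7⟩
    refine ⟨A, h1, (isPeriodic_iff_forall_e P A).2 hper, h2, fun x μ => ?_, fun μ x κ => ?_, h5, fun μ y κ _ => ?_, fun x κ => ?_⟩
    · rw [hw, inv_one, mul_one]; exact h3 x μ
    · rw [hw2, mul_one]; exact h4 μ x κ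
    · rw [hwβ, mul_one, hηβ μ]; exact h6 μ y κ
    · rw [hw3, mul_one]; exact h7 x κ

end

end Summit.QuantumFields.YangMills.BalabanUVNodes.N16.Thm4TorusOfHP2PerEntry
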